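import Summits.ValiantsHypothesis.ValiantsHypothesis.Theorems.DerivedPencilRolle.Negative.DerivedPencilRolleIndefiniteWitness

/-!
# `DerivedPencilRolleQuasi` — negative lemma: the additive exponent `A` is at least `1`

Crux `stmt-ValiantsHypothesis-18064` (`Theses.SymmetroidDescartes.DerivedPencilRolleQuasi`, route
SymmetroidDescartes; the repaired inductive step on the number of terms):
`∃ C A, ∀ m K S d (symmetric, invertible, d strictly increasing),
  Z₊(det F) ≤ C · Z₊(det ∂F) + (K+1)^(A·K) · 2^((log₂ m + 2)^A)`.

Refuter crux-attack findings (2026-08-17). Everything is sorry-free and nothing here asserts a route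
statement positively (Negative/ lane, `--supports stmt-ValiantsHypothesis-18064`).

* `quasiBudget_exponent_zero` : at `A = 0` the budget `(K+1)^(0·K) · 2^((log₂ m+2)^0)` is the
  constant `2`, for all `m, K` — so the `A = 0` instance says "Rolle term plus constant slack `2`".
* `not_derivedPencilRolleQuasi_exponent_zero` : that instance is FALSE for every multiplier `C`:
  the tree's indefinite `2 × 2` four-nomial witness `S₅` (`m = 2`, `K = 3`, file
  `DerivedPencilRolle/Negative/DerivedPencilRolleIndefiniteWitness.lean`: `Z₊(det ∂F) = 0`,
  `Z₊(det F) ≥ 6`) gives `6 ≤ C · 0 + 2`, absurd.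
* `one_le_exponent_of_derivedPencilRolleQuasi_constants` : hence any constants `(C, A)` witnessing
  the crux have `A ≥ 1` (the quasi-polynomial factor cannot degenerate to a constant).

Remarks for the prover/planner (paper, not formalised here). (i) `A ≥ 2` also holds on paper: with
`A = 1` the `K`-fold iteration of the step (glue `QuasiRolleToDescartes`) bounds the alternations of a
`K`-term pencil by `O_{K,C}(m)`, while the landed staircase family behind `not_DerivedPencilRolle`
has `n^L − 1` alternations at `K = L + 2` terms and size `m ≤ 2^(6L+12) n^6` — take `L = 7`.
(ii) `A = 2, C = 0` is consistent with every family in the tree (tropical bump ≤ `2^((1+o(1)) log² m)`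
by Gusfield's breakpoint bound; staircase ≤ `2^(log² m / 36)`). (iii) No finite computation can
refute the crux: with `C = 0`, Descartes' monomial count `C(m+K, K) − 1` is already below the budget
for all `K` whenever `log₂ m < 26` (`A = 2`), `< 68` (`A = 3`), `< 134` (`A = 4`). [folklore]
-/

-- `Summit.ValiantsHypothesis.ValiantsHypothesis.…` repeats a component by the D-0017 layout.
set_option linter.dupNamespace false

namespace Summit.ValiantsHypothesis.ValiantsHypothesis.Theorems.DerivedPencilRolleQuasi.Negative

open Summit.ValiantsHypothesis.ValiantsHypothesis.Theorems.DerivedPencilRolle.Negative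
  (S₅ d₅ S₅_symm S₅_det d₅_strictMono card_posRoots_dF₅ six_le_card_posRoots_F₅)
open scoped BigOperators Matrix
open Polynomial

/-- At exponent `A = 0` the crux budget is the constant `2`, whatever `m` and `K`. [folklore] -/
theorem quasiBudget_exponent_zero (m K : ℕ) :
    (K + 1) ^ (0 * K) * 2 ^ (Nat.log 2 m + 2) ^ 0 = 2 := by
  simp

/-- **The `A = 0` instance of `DerivedPencilRolleQuasi` is false for every multiplier `C`.**
Witness: the tree's indefinite `2 × 2` four-nomial pencil `S₅` (`m = 2`, `K = 3`) with
`Z₊(det ∂F) = 0` and `Z₊(det F) ≥ 6 > 2`. [folklore] -/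
theorem not_derivedPencilRolleQuasi_exponent_zero (C : ℕ) :
    ¬ ∀ (m K : ℕ) (S : Fin (K + 1) → Matrix (Fin m) (Fin m) ℝ) (d : Fin (K + 1) → ℕ),
      (∀ l, (S l).IsSymm) → (∀ l, (S l).det ≠ 0) → StrictMono d →
        ((∑ l, (Polynomial.X : Polynomial ℝ) ^ d l • (S l).map Polynomial.C).det.roots.toFinset.filter
            (fun t => 0 < t)).card ≤
          C * ((∑ l : Fin K, (Polynomial.X : Polynomial ℝ) ^ (d l.succ - d 0 - 1) •
            (((d l.succ - d 0 : ℕ) : ℝ) • S l.succ).map Polynomial.C).det.roots.toFinset.filter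
              (fun t => 0 < t)).card + (K + 1) ^ (0 * K) * 2 ^ (Nat.log 2 m + 2) ^ 0 := by
  intro h
  have h1 := h 2 3 S₅ d₅ S₅_symm S₅_det d₅_strictMono
  rw [card_posRoots_dF₅] at h1
  have h6 : 6 ≤ C * 0 + (3 + 1) ^ (0 * 3) * 2 ^ (Nat.log 2 2 + 2) ^ 0 :=
    six_le_card_posRoots_F₅.trans h1
  simp at h6

/-- The natural strengthening "Rolle term plus a constant additive slack `2`" of the crux is false
for every multiplier `C` (the same witness, slack written as the literal `2`). [folklore] -/
theorem not_rolle_plus_constSlack_two (C : ℕ) :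
    ¬ ∀ (m K : ℕ) (S : Fin (K + 1) → Matrix (Fin m) (Fin m) ℝ) (d : Fin (K + 1) → ℕ),
      (∀ l, (S l).IsSymm) → (∀ l, (S l).det ≠ 0) → StrictMono d →
        ((∑ l, (Polynomial.X : Polynomial ℝ) ^ d l • (S l).map Polynomial.C).det.roots.toFinset.filter
            (fun t => 0 < t)).card ≤
          C * ((∑ l : Fin K, (Polynomial.X : Polynomial ℝ) ^ (d l.succ - d 0 - 1) •
            (((d l.succ - d 0 : ℕ) : ℝ) • S l.succ).map Polynomial.C).det.roots.toFinset.filter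
              (fun t => 0 < t)).card + 2 := by
  intro h
  have h1 := h 2 3 S₅ d₅ S₅_symm S₅_det d₅_strictMono
  rw [card_posRoots_dF₅] at h1
  have h6 : 6 ≤ C * 0 + 2 := six_le_card_posRoots_F₅.trans h1
  omega

/-- **Any constants `(C, A)` witnessing `DerivedPencilRolleQuasi` have `A ≥ 1`.** [folklore] -/
theorem one_le_exponent_of_derivedPencilRolleQuasi_constants (C A : ℕ)
    (h : ∀ (m K : ℕ) (S : Fin (K + 1) → Matrix (Fin m) (Fin m) ℝ) (d : Fin (K + 1) → ℕ),
      (∀ l, (S l).IsSymm) → (∀ l, (S l).det ≠ 0) → StrictMono d →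
        ((∑ l, (Polynomial.X : Polynomial ℝ) ^ d l • (S l).map Polynomial.C).det.roots.toFinset.filter
            (fun t => 0 < t)).card ≤
          C * ((∑ l : Fin K, (Polynomial.X : Polynomial ℝ) ^ (d l.succ - d 0 - 1) •
            (((d l.succ - d 0 : ℕ) : ℝ) • S l.succ).map Polynomial.C).det.roots.toFinset.filter
              (fun t => 0 < t)).card + (K + 1) ^ (A * K) * 2 ^ (Nat.log 2 m + 2) ^ A) :
    1 ≤ A := by
  rcases Nat.eq_zero_or_pos A with rfl | hA
  · exact absurd h (not_derivedPencilRolleQuasi_exponent_zero C)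
  · exact hA

/-- Packaged against the route decl: `DerivedPencilRolleQuasi` can only hold with an exponent
`A ≥ 1` — i.e. the variant of the crux with the extra constraint `A = 0` is false. [folklore] -/
theorem not_derivedPencilRolleQuasi_with_exponent_zero :
    ¬ ∃ C : ℕ, ∀ (m K : ℕ) (S : Fin (K + 1) → Matrix (Fin m) (Fin m) ℝ) (d : Fin (K + 1) → ℕ),
      (∀ l, (S l).IsSymm) → (∀ l, (S l).det ≠ 0) → StrictMono d →
        ((∑ l, (Polynomial.X : Polynomial ℝ) ^ d l • (S l).map Polynomial.C).det.roots.toFinset.filter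
            (fun t => 0 < t)).card ≤
          C * ((∑ l : Fin K, (Polynomial.X : Polynomial ℝ) ^ (d l.succ - d 0 - 1) •
            (((d l.succ - d 0 : ℕ) : ℝ) • S l.succ).map Polynomial.C).det.roots.toFinset.filter
              (fun t => 0 < t)).card + (K + 1) ^ (0 * K) * 2 ^ (Nat.log 2 m + 2) ^ 0 :=
  fun ⟨C, h⟩ => not_derivedPencilRolleQuasi_exponent_zero C h

end Summit.ValiantsHypothesis.ValiantsHypothesis.Theorems.DerivedPencilRolleQuasi.Negative
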